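import Literature.AlgebraicGeometry.Resolution.KawasakiChartBaseChange
import Mathlib.RingTheory.Regular.RegularSequence
import HarnessLib

/-!
# Two-chart compatibility of Kawasaki's annihilator ideals: the chart ideals of a homogeneous
ideal and of a list of forms

Topic: `Literature/AlgebraicGeometry/Resolution` (plumbing of the global step of Kawasaki's
Macaulayfication, Kawasaki 2000, La. 5.3 / proof of Thm. 5.1, p. 2539). Companion of
`KawasakiChartBaseChange.lean`, whose `chartAnn_map_awayMap_eq` compares the annihilator ideals of
two charts of a closed subscheme `Z ⊆ ℙⁿ_k` given that the chart ideals extend to a common ideal on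
the overlap. This file supplies that hypothesis in the two currencies of the assembly of Kawasaki's
Thm. 5.1:

* HOMOGENEOUS-IDEAL currency (the selection step: `J = I_X + (r_1, …, r_{i-1}) ≤ k[x₀, …, xₙ]`
  homogeneous, chart ideal `I_J(j) = (J · (k[x]_{(x_j)})₀) · Γ(Z, Z_{x_j})`, i.e.
  `(J.map (dehomAway j)).map (evalAway (x_j))`): `Ideal.map_eq_map_of_isHomogeneous_of_unit_mul`
  (two ring maps that agree on degree-`m` forms up to the factor `u^m`, `u` a unit, have the same
  image of a homogeneous ideal), `map_dehomAway_map_evalAway_overlap_eq`,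
  `chartAnn_map_awayMap_eq_of_isHomogeneous`;
* LIST currency (the pointwise step, `KawasakiPointwise.lean`: `J l = (g_l, …, g_{d-1})`,
  `KawasakiChartStalk.lean`: `Ideal.ofList (bs.map (evalAway ι (X j)))`): for forms
  `z_0, …, z_{d-1}` of degrees `N_i` and a cut `t`, `ofList_evalAway_mk_drop_map_eq` and
  `chartAnn_map_awayMap_eq_of_formList`.

In both cases the generators on the two charts differ by the units `(x_j/x_l)^m` of the overlap
ring (`awayMap_mk_eq_pow_mul_awayMap_mk`, `isUnit_awayMap_isLocalizationElem`).

Everything is proved; no named facts; no definitions. As in `KawasakiCharts.lean`, Mathlib's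
`MvPolynomial.gradedAlgebra` (a `def`) is a local instance.

## References

* T. Kawasaki, *On Macaulayfication of Noetherian schemes*, Trans. AMS 352 (2000), La. 5.3 and
  the proof of Thm. 5.1 (p. 2539). [Kawasaki2000]
* R. Hartshorne, *Algebraic Geometry* (1977), II Prop. 2.5 (b). [Hartshorne1977]
-/

noncomputable section

open CategoryTheory AlgebraicGeometry TopologicalSpace HomogeneousLocalization MvPolynomial
open Literature.AlgebraicGeometry.Morphisms Literature.AlgebraicGeometry.Morphisms.ProjCech
open Literature.AlgebraicGeometry.Motives Literature.AlgebraicGeometry.Motives.ProjFrac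

universe u

attribute [local instance] MvPolynomial.gradedAlgebra

namespace Literature.AlgebraicGeometry.Resolution

variable {k : Type u} [Field k] {n : ℕ}

/-! ## Homogeneous ideals under two ring maps that agree on forms up to units -/

/-- **Two ring maps that agree on forms up to units have the same image of a homogeneous ideal.**
If `ψ G = u^m · φ G` for every form `G` of degree `m`, with `u` a unit, then `J · R` computed through
`φ` and through `ψ` coincide for every homogeneous ideal `J` (a homogeneous ideal is spanned by its
homogeneous elements). [cite: Hartshorne1977, II Prop. 2.5 (b) (proof)] -/
theorem Ideal.map_eq_map_of_isHomogeneous_of_unit_mul {R : Type*} [CommRing R]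
    {J : Ideal (MvPolynomial (Fin (n + 1)) k)} (hJ : J.IsHomogeneous (grading k n))
    (φ ψ : MvPolynomial (Fin (n + 1)) k →+* R) (u : R) (hu : IsUnit u)
    (h : ∀ (m : ℕ) (G : MvPolynomial (Fin (n + 1)) k), G ∈ grading k n m → ψ G = u ^ m * φ G) :
    J.map φ = J.map ψ := by
  obtain ⟨S, rfl⟩ := (Ideal.IsHomogeneous.iff_exists (𝒜 := grading k n) _).mp hJ
  rw [Ideal.map_span, Ideal.map_span]
  refine le_antisymm (Ideal.span_le.mpr ?_) (Ideal.span_le.mpr ?_)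
  · rintro _ ⟨_, ⟨x, hx, rfl⟩, rfl⟩
    obtain ⟨m, hm⟩ : SetLike.IsHomogeneousElem (grading k n) (x : MvPolynomial (Fin (n + 1)) k) := x.2
    obtain ⟨v, hv⟩ := hu.pow m
    have : φ x = ↑v⁻¹ * ψ x := by rw [h m x hm, ← hv, ← mul_assoc, Units.inv_mul, one_mul]
    rw [SetLike.mem_coe, this]
    exact Ideal.mul_mem_left _ _ (Ideal.subset_span ⟨x, ⟨x, hx, rfl⟩, rfl⟩)
  · rintro _ ⟨_, ⟨x, hx, rfl⟩, rfl⟩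
    obtain ⟨m, hm⟩ : SetLike.IsHomogeneousElem (grading k n) (x : MvPolynomial (Fin (n + 1)) k) := x.2
    rw [SetLike.mem_coe, h m x hm]
    exact Ideal.mul_mem_left _ _ (Ideal.subset_span ⟨x, ⟨x, hx, rfl⟩, rfl⟩)

variable {Z : Scheme.{u}} (ι : Z ⟶ PP k n)

/-- **The chart ideals of a homogeneous ideal extend to a common ideal on the overlap.** For a
homogeneous `J ≤ k[x₀, …, xₙ]`, the chart ideals `(J · (k[x]_{(x_j)})₀) · Γ(Z, Z_{x_j})`
(dehomogenise with `dehomAway j`, evaluate with `evalAway (x_j)`) of the charts `j` and `l` generate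
the same ideal of `Γ(Z, Z_{x_j x_l})`: on a form `G` of degree `m` the two composites
`k[x] → Γ(Z, Z_{x_j x_l})` differ by the unit `(x_j/x_l)^m`. [cite: Kawasaki2000, proof of La. 5.3] -/
theorem map_dehomAway_map_evalAway_overlap_eq {J : Ideal (MvPolynomial (Fin (n + 1)) k)}
    (hJ : J.IsHomogeneous (grading k n)) (j l : Fin (n + 1)) :
    ((J.map (dehomAway k n j)).map (evalAway ι (X j))).map
        (Z.presheaf.map (homOfLE (ZH_mono ι ⟨X l, rfl⟩)).op).hom =
      ((J.map (dehomAway k n l)).map (evalAway ι (X l))).map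
        (Z.presheaf.map (homOfLE (ZH_mono ι ⟨X j, mul_comm (X j) (X l)⟩)).op).hom := by
  rw [Ideal.map_map, Ideal.map_map, Ideal.map_map, Ideal.map_map]
  refine Ideal.map_eq_map_of_isHomogeneous_of_unit_mul hJ _ _
    (evalAway ι (X j * X l) (awayMap (grading k n) (Segre.X_mem k j)
      (mul_comm (X j) (X l) : (X j * X l : MvPolynomial (Fin (n + 1)) k) = X l * X j)
      (Away.isLocalizationElem (Segre.X_mem k l) (Segre.X_mem k j))))
    ((isUnit_awayMap_isLocalizationElem (k := k) j l).map _) fun m G hG => ?_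
  simp only [RingHom.comp_apply]
  rw [dehomAway_of_mem j hG, dehomAway_of_mem l hG, ← evalAway_awayMap ι (Segre.X_mem k l) rfl,
    ← evalAway_awayMap ι (Segre.X_mem k j) (mul_comm (X j) (X l)),
    awayMap_mk_eq_pow_mul_awayMap_mk j l m G (by simpa using hG), map_mul, map_pow]

/-- **Two-chart compatibility for the chart ideals of a homogeneous ideal** (Kawasaki's La. 5.3 for
`J = I_X + (r_1, …, r_{i-1})`): the annihilator ideals of the charts `j` and `l` computed from the
chart ideals `(J · (k[x]_{(x_j)})₀) · Γ(Z, Z_{x_j})` agree on the overlap ring `(k[x]_{(x_j x_l)})₀`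
(positive window) — the hypothesis `hcompat` of `KawasakiHomogeneousAnnihilator.lean` for this
family of chart ideals. [cite: Kawasaki2000, La. 5.3] -/
theorem chartAnn_map_awayMap_eq_of_isHomogeneous [IsClosedImmersion ι]
    {J : Ideal (MvPolynomial (Fin (n + 1)) k)} (hJ : J.IsHomogeneous (grading k n)) (T : Finset ℕ)
    (hT : ∀ q ∈ T, 1 ≤ q) (j l : Fin (n + 1)) :
    (chartAnn ι j ((J.map (dehomAway k n j)).map (evalAway ι (X j))) T).map
        (awayMap (grading k n) (Segre.X_mem k l)
          (rfl : (X j * X l : MvPolynomial (Fin (n + 1)) k) = X j * X l)) =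
      (chartAnn ι l ((J.map (dehomAway k n l)).map (evalAway ι (X l))) T).map
        (awayMap (grading k n) (Segre.X_mem k j)
          (mul_comm (X j) (X l) : (X j * X l : MvPolynomial (Fin (n + 1)) k) = X l * X j)) :=
  chartAnn_map_awayMap_eq ι j l _ _ _ rfl (map_dehomAway_map_evalAway_overlap_eq ι hJ j l).symm T hT

/-! ## Lists of forms -/

/-- **Lists whose entries differ by units generate the same ideal.** [folklore] -/
private theorem Ideal.ofList_eq_of_getElem_unit_mul {R : Type*} [CommRing R] (as bs : List R)
    (hlen : as.length = bs.length)
    (h : ∀ (i : ℕ) (hi : i < as.length), ∃ u : R, IsUnit u ∧ bs[i]'(hlen ▸ hi) = u * as[i]) :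
    Ideal.ofList as = Ideal.ofList bs := by
  refine le_antisymm (Ideal.span_le.mpr ?_) (Ideal.span_le.mpr ?_)
  · intro a ha
    obtain ⟨i, hi, rfl⟩ := List.mem_iff_getElem.mp ha
    obtain ⟨u, hu, hb⟩ := h i hi
    obtain ⟨v, rfl⟩ := hu
    have : as[i] = ↑v⁻¹ * bs[i]'(hlen ▸ hi) := by rw [hb, ← mul_assoc, Units.inv_mul, one_mul]
    rw [SetLike.mem_coe, this]
    exact Ideal.mul_mem_left _ _ (Ideal.subset_span (List.getElem_mem _))
  · intro b hb
    obtain ⟨i, hi, rfl⟩ := List.mem_iff_getElem.mp hb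
    obtain ⟨u, -, hb⟩ := h i (hlen ▸ hi)
    rw [SetLike.mem_coe, hb]
    exact Ideal.mul_mem_left _ _ (Ideal.subset_span (List.getElem_mem _))

variable {d : ℕ} (z : Fin d → MvPolynomial (Fin (n + 1)) k) (N : Fin d → ℕ)
  (hz : ∀ i, z i ∈ grading k n (N i • 1))

/-- **The chart ideals of a list of forms extend to a common ideal on the overlap.** For forms
`z_i` of degrees `N_i` and a cut `t`, the ideal of `Γ(Z, Z_{x_j})` generated by
`evalAway (x_j) (z_i / x_j^{N_i})`, `i ≥ t`, and the ideal of `Γ(Z, Z_{x_l})` generated by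
`evalAway (x_l) (z_i / x_l^{N_i})`, `i ≥ t`, generate the same ideal of `Γ(Z, Z_{x_j x_l})` (the
generators differ by the units `(x_j/x_l)^{N_i}`). The degree hypotheses are in the form `N i • 1`
of `Away.mk`; any proofs may be used, by proof irrelevance. [cite: Kawasaki2000, proof of La. 5.3] -/
theorem ofList_evalAway_mk_drop_map_eq (t : ℕ) (j l : Fin (n + 1)) :
    (Ideal.ofList (((List.ofFn fun i => Away.mk (grading k n) (Segre.X_mem k j) (N i) (z i) (hz i)).drop
        t).map (evalAway ι (X j)))).map
      (Z.presheaf.map (homOfLE (ZH_mono ι ⟨X l, rfl⟩)).op).hom =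
    (Ideal.ofList (((List.ofFn fun i => Away.mk (grading k n) (Segre.X_mem k l) (N i) (z i) (hz i)).drop
        t).map (evalAway ι (X l)))).map
      (Z.presheaf.map (homOfLE (ZH_mono ι ⟨X j, mul_comm (X j) (X l)⟩)).op).hom := by
  rw [Ideal.map_ofList, Ideal.map_ofList, List.map_map, List.map_map]
  refine Ideal.ofList_eq_of_getElem_unit_mul _ _ (by simp) fun i hi => ?_
  have hi' : t + i < d := by
    have h := hi
    simp only [List.length_map, List.length_drop, List.length_ofFn] at h
    omega
  refine ⟨evalAway ι (X j * X l) (awayMap (grading k n) (Segre.X_mem k j)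
      (mul_comm (X j) (X l) : (X j * X l : MvPolynomial (Fin (n + 1)) k) = X l * X j)
      (Away.isLocalizationElem (Segre.X_mem k l) (Segre.X_mem k j))) ^ N ⟨t + i, hi'⟩,
    ((isUnit_awayMap_isLocalizationElem (k := k) j l).map _).pow _, ?_⟩
  simp only [List.getElem_map, List.getElem_drop, List.getElem_ofFn, Function.comp_apply]
  rw [← evalAway_awayMap ι (Segre.X_mem k l) rfl, ← evalAway_awayMap ι (Segre.X_mem k j)
    (mul_comm (X j) (X l)), awayMap_mk_eq_pow_mul_awayMap_mk j l (N _) (z _) (hz _), map_mul, map_pow]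

/-- **Two-chart compatibility for the chart ideals of a list of forms** (Kawasaki's
`(z_t, …, z_{d-1})` on the charts `Z_{x_j}`, in the list currency of the pointwise step): the
annihilator ideals of the two charts agree on the overlap ring, for a positive window `T`.
[cite: Kawasaki2000, La. 5.3, proof of Thm. 5.1] -/
theorem chartAnn_map_awayMap_eq_of_formList [IsClosedImmersion ι] (t : ℕ) (T : Finset ℕ)
    (hT : ∀ q ∈ T, 1 ≤ q) (j l : Fin (n + 1)) :
    (chartAnn ι j (Ideal.ofList (((List.ofFn fun i =>
        Away.mk (grading k n) (Segre.X_mem k j) (N i) (z i) (hz i)).drop t).map (evalAway ι (X j)))) T).map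
        (awayMap (grading k n) (Segre.X_mem k l)
          (rfl : (X j * X l : MvPolynomial (Fin (n + 1)) k) = X j * X l)) =
      (chartAnn ι l (Ideal.ofList (((List.ofFn fun i =>
        Away.mk (grading k n) (Segre.X_mem k l) (N i) (z i) (hz i)).drop t).map (evalAway ι (X l)))) T).map
        (awayMap (grading k n) (Segre.X_mem k j)
          (mul_comm (X j) (X l) : (X j * X l : MvPolynomial (Fin (n + 1)) k) = X l * X j)) :=
  chartAnn_map_awayMap_eq ι j l _ _ _ rfl (ofList_evalAway_mk_drop_map_eq ι z N hz t j l).symm T hT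

end Literature.AlgebraicGeometry.Resolution

end
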